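import Summits.BirchSwinnertonDyer.BirchSwinnertonDyer.Theses.PrintX8VS
import Summits.BirchSwinnertonDyer.BirchSwinnertonDyer.Theorems.PrintX8Glue
import Summits.BirchSwinnertonDyer.BirchSwinnertonDyer.Theorems.PrintX8Assembly
import Summits.BirchSwinnertonDyer.BirchSwinnertonDyer.Theorems.PrintX8MuGlue
import Summits.BirchSwinnertonDyer.BirchSwinnertonDyer.Theorems.PrintX8MainConjectureSplit
import Summits.BirchSwinnertonDyer.BirchSwinnertonDyer.Theorems.PrintX8VerticalStevens
import Summits.BirchSwinnertonDyer.BirchSwinnertonDyer.Theorems.PrintX8VerticalStevensSpan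
import HarnessLib

/-!
# Route `PrintX8VS` (THEOREM-B road to the X8 leaf; planner g6, 2026-08-27T20:20Z): the glue items
# `GlueRankOneLinkX8` (21707), `GlueRankZeroLinkX8` (21708), the `Assembly` (21709) and the span glue
# `GlueMainConjectureOfSpanX8` (21706) — PROVED, by name, from landed theorems of route `PrintX8`

Cell `bsd-print-x8`, seat p3 (gen 4; strategy sentence «does BSTW 2024 cover `a_p ≠ 0` at `p = 3`?
NO ⇒ the exact missing input is the crux»). HONEST FRAMING: pure re-plumbing; every `PrintX8VS` decl
below is, after unfolding one definition, SYNTACTICALLY the corresponding `PrintX8` decl (the planner filed the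
sister route with fully-qualified bodies), so the closed glue/assembly theorems of `PrintX8`
(`PrintX8Glue.glueRankOneLinkX8_holds` / `glueRankZeroLinkX8_holds` p536888, `PrintX8Assembly.assembly_holds`
p534640) prove the sister items verbatim, and the ONE new glue — K1 → SPAN → held inputs → published
bundle → C1 — is the composition of the landed VS road: `eisSpanModGen_of_conjSpanGen` (ty2 carrier
p561961) ⟶ `PrintX8VerticalStevens.cycWindingNonConstantSmallImageX8_of_spanModAtThree` (p1 g4, p564724:
VS-0 ⟹ VS-1) ⟶ `muBoundSmallImageX8_of_inputSharpFlatMuTransfer_of_cycWinding` (p3 g3, p561175: VS-1 +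
20771 ⟹ Mu) ⟶ `PrintX8MuBoundGlue.glueMuBoundSmallImageX8_holds` (K1 + Mu + Pub ⟹ small-image MC)
⟶ `PrintX8MainConjectureSplit.glueMainConjectureX8_holds` (K1 + small-image MC + Pub ⟹ C1).
No census cell moves; PARTITION 0; BSD is not proved by any of this; «beyond-print theorem: NO»
(bookkeeping). What remains OPEN on `PrintX8VS` after these four items: the crux `ConjSpanGenAll`
(THEOREM B — kernel-checked by bsd-f3-mu-an g5 modulo the printed inputs (L) Morris 2007 Thm 6.1(2)
and (C) Serre 1970; landing = ty2 g6's `ConjSpanGenAllLevels.lean`), K1 `SprungLowerDivisibilityAtThree`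
(the residual, OPEN IN PRINT at `a₃ = ±3`), and the held/published input items.

References: route files `Theses/PrintX8VS.lean` (items 21705–21709), `Theses/PrintX8.lean`;
[Sprung2012] Thm. 7.14, Prop. 7.19; [Pollack2003] Def. 6.15; [Miller2011LMS] Def. 1.1;
[BurungaleKobayashiOta2023] App. A Cor. A.5; [Sprung2024] §5.2.
-/

set_option autoImplicit false
-- justification: the mandated namespace `Summit.BirchSwinnertonDyer.BirchSwinnertonDyer.Theorems`
-- (single-conjunct summit, Sub = Summit) repeats a segment by design (D-0017).
set_option linter.dupNamespace false

noncomputable section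

namespace Summit.BirchSwinnertonDyer.BirchSwinnertonDyer.Theorems.PrintX8VSGlue

open Literature.NumberTheory.EllipticCurves Literature.NumberTheory.EllipticCurves.Rank1Residual
  Summit.BirchSwinnertonDyer.BirchSwinnertonDyer.Theorems
  Summit.BirchSwinnertonDyer.BirchSwinnertonDyer.Theses

/-- **Item 21707 `PrintX8VS.GlueRankOneLinkX8` (published bundle → GZK → C2).** The decls of the sister
route unfold to those of `PrintX8` on the nose, so `PrintX8Glue.glueRankOneLinkX8_holds` (item 20408,
p536888: Burungale–Kobayashi–Ota App. A Cor. A.5 in the ♯/♭ reading, instantiated on class X8) is the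
proof. [cite: BurungaleKobayashiOta2023, App. A Cor. A.5] -/
theorem glueRankOneLinkX8_holds : PrintX8VS.GlueRankOneLinkX8 :=
  fun hPub hGZK ↦ PrintX8Glue.glueRankOneLinkX8_holds hPub hGZK

/-- **Item 21708 `PrintX8VS.GlueRankZeroLinkX8` (published bundle → GZK → C3).** Verbatim
`PrintX8Glue.glueRankZeroLinkX8_holds` (item 20409, p536888: Sprung 2024 §5.2, Lemmas 5.5–5.9 all `N`,
on class X8). [cite: Sprung2024, §5.2, Lemma 5.9 and Thm. 5.3] -/
theorem glueRankZeroLinkX8_holds : PrintX8VS.GlueRankZeroLinkX8 :=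
  fun hPub hGZK ↦ PrintX8Glue.glueRankZeroLinkX8_holds hPub hGZK

/-- **Item 21709 `PrintX8VS.Assembly` (C1 → C2 → C3 → GZK → the X8 leaf `WAllCornerX8`).** Verbatim
`PrintX8Assembly.assembly_holds` (item 20314, p534640: case split on the analytic rank, the link of that
rank, `Typed.bsdp_of_missingPPartAt`). [cite: Miller2011LMS, §1 and Def. 1.1] -/
theorem assembly_holds : PrintX8VS.Assembly :=
  fun h1 h2 h3 hGZK ↦ PrintX8Assembly.assembly_holds h1 h2 h3 hGZK

/-- **THEOREM B's conclusion at `p = 3` gives crux 20622 `MuBoundSmallImageX8` of route `PrintX8`, BY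
NAME, from the held input item 20771** (`InputSharpFlatMuTransfer` = Sprung 2012's ♯/♭ Coleman–Kato
package ∧ the period unit at `3`): `ConjSpanGen N 3` at every level `N` prime to `3` ⟹ the mod-`3` span
`EisSpanModGen N 3` (`eisSpanModGen_of_conjSpanGen`) ⟹ VS-1 on every small-image X8 pair (p1 g4's
`cycWindingNonConstantSmallImageX8_of_spanModAtThree`, the bridge VS-B + `a₃ ≢ 1 (mod 3)`) ⟹ Mu (p3 g3's
one-colour collapse + Euler-system `μ`-transfer `muBoundSmallImageX8_of_inputSharpFlatMuTransfer_of_cycWinding`).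
[cite: Pollack2003, Def. 6.15] [cite: Sprung2012, Def. 6.1, Thm. 7.14 and Prop. 7.19] -/
theorem muBoundSmallImageX8_of_conjSpanGenAll (hSpan : PrintX8VS.ConjSpanGenAll)
    (hIn : PrintX8.InputSharpFlatMuTransfer) : PrintX8.MuBoundSmallImageX8 :=
  PrintX8VerticalStevens.muBoundSmallImageX8_of_inputSharpFlatMuTransfer_of_cycWinding hIn
    (PrintX8VerticalStevens.cycWindingNonConstantSmallImageX8_of_spanModAtThree
      fun M _ h3M ↦ eisSpanModGen_of_conjSpanGen (hSpan M 3 Nat.prime_three h3M))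

/-- **Item 21706 `PrintX8VS.GlueMainConjectureOfSpanX8` (K1 → SPAN → held inputs → published bundle →
C1), PROVED.** Composition: SPAN + 20771 ⟹ Mu (`muBoundSmallImageX8_of_conjSpanGenAll`); K1 + Mu + Pub
⟹ the small-image ♯/♭ main conjecture (`PrintX8MuBoundGlue.glueMuBoundSmallImageX8_holds`, item 20623);
K1 + that + Pub ⟹ C1 (`PrintX8MainConjectureSplit.glueMainConjectureX8_holds`, item 20404: surjective
branch = Λ a UFD, non-surjective branch = the small-image statement). The sister decls unfold to
`PrintX8`'s verbatim. [cite: Sprung2012, Thm. 7.14, Thm. 7.16 and Prop. 7.19] [cite: Pollack2003, Def. 6.15] -/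
theorem glueMainConjectureOfSpanX8_holds : PrintX8VS.GlueMainConjectureOfSpanX8 :=
  fun hK1 hSpan hIn hPub ↦
    PrintX8MainConjectureSplit.glueMainConjectureX8_holds hK1
      (PrintX8MuBoundGlue.glueMuBoundSmallImageX8_holds hK1
        (muBoundSmallImageX8_of_conjSpanGenAll hSpan hIn) hPub) hPub

/-- **The X8 leaf from the sister route's open inputs, in ONE kernel theorem** (= `PrintX8VS.closes` with
its four glue/assembly items DISCHARGED by this file): K1 (`SprungLowerDivisibilityAtThree`, the
residual crux — OPEN IN PRINT at `a₃ = ±3`), THEOREM B's conclusion `ConjSpanGenAll`, the held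
Coleman–Kato/period input 20771, the published bundle, and Gross–Zagier–Kolyvagin give `WAllCornerX8`.
After THEOREM B lands (modulo (L) Morris 2007 Thm 6.1(2) and (C) Serre 1970), the exact missing input of
leaf X8 is K1 ALONE. [cite: Miller2011LMS, §1 and Def. 1.1] [cite: Sprung2012, Main Conj. 7.21] -/
theorem wAllCornerX8_of_K1_of_conjSpanGenAll (hK1 : PrintX8VS.SprungLowerDivisibilityAtThree)
    (hSpan : PrintX8VS.ConjSpanGenAll) (hIn : PrintX8VS.InputSharpFlatMuTransfer)
    (hPub : PrintX8VS.PublishedInputsX8) (hGZK : PrintX8VS.RankEqAnalyticRankLeOne) :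
    Summit.BirchSwinnertonDyer.WAllCornerX8 :=
  -- buildfix (p3 g4, route rev 2 re-cut `closes` with a `PublishedInputsX8Core` binder): compose the four
  -- proved items directly instead of calling `PrintX8VS.closes`, so route edits cannot break this file.
  assembly_holds (glueMainConjectureOfSpanX8_holds hK1 hSpan hIn hPub) (glueRankOneLinkX8_holds hPub hGZK)
    (glueRankZeroLinkX8_holds hPub hGZK) hGZK

end Summit.BirchSwinnertonDyer.BirchSwinnertonDyer.Theorems.PrintX8VSGlue

end
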